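import Mathlib
import HarnessLib

/-!
# Counting bad blocks under one-sided conditional bounds: if each block is bad with conditional
# probability at most `q` given the record of the earlier blocks, the number of bad blocks has
# Chernoff tails — `P(#bad ≥ k) ≤ (1 − q + q a)^R / a^k`, and `≤ e^{−R/8}` at `k ≥ R/2`, `q ≤ 1/4`

HONEST FRAMING: exact (Metropolis-corrected) sampling algorithms for lattice gauge theory;
figures of merit are autocorrelation/cost numbers at stated couplings and volumes; no
continuum-physics claim.

Venture `LatticeQCDFlow` (cell pub-lqcd), topic `Scoring`; FANOUT row 8 (`s0-cpn-nemc`, GEN-15).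
NEW WORK of the cell, not a published result; no definition is introduced.  The median-of-streams
confidence of `Scoring/ReplicaChains.lean` uses INDEPENDENT streams and Mathlib's Hoeffding
inequality.  Blocks of ONE stream are not independent; what the split chain delivers
(`Scoring/SplitChainGaps.splitChain_gap_le`) is one-sided: given any nonnegative functional of
the record so far, the next block is bad with weight at most `q`.  This file shows that this is
enough for the same exponential count bound, by an elementary supermartingale-free induction:
`u_{R+1}(k) ≤ (1 − q) u_R(k) + q u_R(k − 1)` for `u_R(k) = P(#{j < R : bad_j} ≥ k)`, hence
`u_R(k) ≤ (1 − q + q a)^R / a^k` for every `a ≥ 1` (the generating-function / Chernoff bound of the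
Binomial(`R`, `q`) tail, which dominates), and the numerical corollary `u_R(⌈R/2⌉) ≤ e^{−R/8}` for
`q ≤ 1/4` (`a = 3`).  Abstract: any probability space, any `0/1`-valued measurable `χ_j`.  Printed
counterpart NAMED ONLY: stochastic domination of dependent Bernoulli sums by binomials / Chernoff's
bound (folklore; e.g. Dubhashi–Panconesi 2009, *Concentration of Measure for the Analysis of
Randomized Algorithms*, §1.6–1.7); nothing is cited as a fact.

## Content (`μ` a probability measure on `α`; `χ : ℕ → α → ℝ` measurable with values in `{0, 1}`;
## `S_R = Σ_{j<R} χ_j`; HYPOTHESIS `hcond`: for all `j`, `c`: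
## `∫ 1{S_j = c} χ_j dμ ≤ q · μ{S_j = c}`)

* `exists_nat_eq_sum_zeroOne` — `S_R` takes natural-number values; `indicator_count_succ_le`,
  `indicator_count_pred_eq` — the two pointwise identities behind the recursion;
* **`measureReal_countGe_succ_le`** — `μ{S_{R+1} ≥ k} ≤ (1 − q) μ{S_R ≥ k} + q μ{S_R ≥ k − 1}`
  (`k ≥ 1`);
* **`measureReal_countGe_le`** — for every `a ≥ 1`: `μ{S_R ≥ k} ≤ (1 − q + q a)^R / a^k`;
* `three_halves_pow_div_le_exp` — `R ≤ 2k ⇒ (3/2)^R / 3^k ≤ e^{−R/8}` (from `e^{1/4} ≤ 4/3`, proved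
  inline);
* **`measureReal_countGe_half_le_exp`** — for `0 ≤ q ≤ 1/4`: `μ{S_R ≥ R/2} ≤ e^{−R/8}`.

NOT CLAIMED: optimality of `1/8`; two-sided or variance-sensitive (Bernstein) versions.
-/

noncomputable section

namespace Summit.Ventures.LatticeQCDFlow.Scoring

open MeasureTheory ProbabilityTheory Filter Finset
open scoped ENNReal

variable {α : Type*} [MeasurableSpace α]

/-! ### Pointwise: sums of `0/1` values -/

section Pointwise

variable {χ : ℕ → α → ℝ}

omit [MeasurableSpace α] in
/-- A sum of `0/1`-valued functions takes natural-number values. -/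
theorem exists_nat_eq_sum_zeroOne (hχ : ∀ j ω, χ j ω = 0 ∨ χ j ω = 1) (ω : α) :
    ∀ R : ℕ, ∃ n : ℕ, ∑ i ∈ Finset.range R, χ i ω = n
  | 0 => ⟨0, by simp⟩
  | R + 1 => by
    obtain ⟨n, hn⟩ := exists_nat_eq_sum_zeroOne hχ ω R
    rcases hχ R ω with h | h
    · exact ⟨n, by rw [Finset.sum_range_succ, hn, h, add_zero]⟩
    · exact ⟨n + 1, by rw [Finset.sum_range_succ, hn, h]; push_cast; ring⟩

/-- The recursion, pointwise: `1{k ≤ S + χ} ≤ 1{k ≤ S} + 1{S = k − 1} χ` for `S ∈ ℕ`, `χ ∈ {0,1}`,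
`k ≥ 1`. -/
theorem indicator_count_succ_le {S x : ℝ} {n : ℕ} (hS : S = n) (hx : x = 0 ∨ x = 1) {k : ℕ}
    (hk : 1 ≤ k) :
    (if (k : ℝ) ≤ S + x then (1 : ℝ) else 0)
      ≤ (if (k : ℝ) ≤ S then (1 : ℝ) else 0) + (if S = ((k - 1 : ℕ) : ℝ) then (1 : ℝ) else 0) * x := by
  subst hS
  rcases hx with rfl | rfl
  · rw [add_zero, mul_zero, add_zero]
  · rw [mul_one]
    have e1 : ((k : ℝ) ≤ (n : ℝ) + 1) ↔ k ≤ n + 1 := by exact_mod_cast Iff.rfl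
    have e2 : ((k : ℝ) ≤ (n : ℝ)) ↔ k ≤ n := by exact_mod_cast Iff.rfl
    have e3 : ((n : ℝ) = ((k - 1 : ℕ) : ℝ)) ↔ n = k - 1 := by exact_mod_cast Iff.rfl
    by_cases h2 : k ≤ n
    · rw [if_pos (e1.2 (by omega)), if_pos (e2.2 h2), if_neg (fun h => by have := e3.1 h; omega)]
      norm_num
    · by_cases h3 : n = k - 1
      · rw [if_pos (e1.2 (by omega)), if_neg (fun h => h2 (e2.1 h)), if_pos (e3.2 h3)]
        norm_num
      · rw [if_neg (fun h => by have := e1.1 h; omega), if_neg (fun h => h2 (e2.1 h)),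
          if_neg (fun h => h3 (e3.1 h))]
        norm_num

/-- Integrality, pointwise: `1{k − 1 ≤ S} = 1{S = k − 1} + 1{k ≤ S}` for `S ∈ ℕ`, `k ≥ 1`. -/
theorem indicator_count_pred_eq {S : ℝ} {n : ℕ} (hS : S = n) {k : ℕ} (hk : 1 ≤ k) :
    (if ((k - 1 : ℕ) : ℝ) ≤ S then (1 : ℝ) else 0)
      = (if S = ((k - 1 : ℕ) : ℝ) then (1 : ℝ) else 0) + (if (k : ℝ) ≤ S then (1 : ℝ) else 0) := by
  subst hS
  have e1 : (((k - 1 : ℕ) : ℝ) ≤ (n : ℝ)) ↔ k - 1 ≤ n := by exact_mod_cast Iff.rfl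
  have e2 : ((k : ℝ) ≤ (n : ℝ)) ↔ k ≤ n := by exact_mod_cast Iff.rfl
  have e3 : ((n : ℝ) = ((k - 1 : ℕ) : ℝ)) ↔ n = k - 1 := by exact_mod_cast Iff.rfl
  by_cases h2 : k ≤ n
  · rw [if_pos (e1.2 (by omega)), if_neg (fun h => by have := e3.1 h; omega), if_pos (e2.2 h2)]
    norm_num
  · by_cases h3 : n = k - 1
    · rw [if_pos (e1.2 (by omega)), if_pos (e3.2 h3), if_neg (fun h => h2 (e2.1 h))]
      norm_num
    · rw [if_neg (fun h => by have := e1.1 h; omega), if_neg (fun h => h3 (e3.1 h)),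
        if_neg (fun h => h2 (e2.1 h))]
      norm_num

end Pointwise

/-! ### The recursion and the Chernoff-type bound -/

section Count

variable (μ : Measure α) [IsProbabilityMeasure μ] {χ : ℕ → α → ℝ}

omit [IsProbabilityMeasure μ] in
/-- The count `S_R` is measurable. -/
theorem measurable_count (hχm : ∀ j, Measurable (χ j)) (R : ℕ) :
    Measurable fun ω => ∑ i ∈ Finset.range R, χ i ω :=
  Finset.measurable_sum _ fun i _ => hχm i

omit [IsProbabilityMeasure μ] in
/-- `μ{k ≤ S_R}` as the integral of an indicator written with `if`. -/
theorem measureReal_countGe_eq_integral (hχm : ∀ j, Measurable (χ j)) (R : ℕ) (t : ℝ) :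
    μ.real {ω | t ≤ ∑ i ∈ Finset.range R, χ i ω}
      = ∫ ω, (if t ≤ ∑ i ∈ Finset.range R, χ i ω then (1 : ℝ) else 0) ∂μ := by
  rw [← integral_indicator_one (measurableSet_le measurable_const (measurable_count hχm R))]
  refine integral_congr_ae (ae_of_all _ fun ω => ?_)
  simp only [Set.indicator_apply, Set.mem_setOf_eq, Pi.one_apply]

omit [IsProbabilityMeasure μ] in
/-- `μ{S_R = c}` as the integral of an indicator written with `if`. -/
theorem measureReal_countEq_eq_integral (hχm : ∀ j, Measurable (χ j)) (R : ℕ) (t : ℝ) :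
    μ.real {ω | ∑ i ∈ Finset.range R, χ i ω = t}
      = ∫ ω, (if ∑ i ∈ Finset.range R, χ i ω = t then (1 : ℝ) else 0) ∂μ := by
  have hE : MeasurableSet {ω | ∑ i ∈ Finset.range R, χ i ω = t} :=
    (measurable_count hχm R) (measurableSet_singleton t)
  rw [← integral_indicator_one hE]
  refine integral_congr_ae (ae_of_all _ fun ω => ?_)
  simp only [Set.indicator_apply, Set.mem_setOf_eq, Pi.one_apply]

/-- **THE RECURSION.**  Under the one-sided conditional bound `hcond`, for every `R` and `k ≥ 1`:
`μ{S_{R+1} ≥ k} ≤ (1 − q) μ{S_R ≥ k} + q μ{S_R ≥ k − 1}`. -/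
theorem measureReal_countGe_succ_le (hχm : ∀ j, Measurable (χ j))
    (hχ : ∀ j ω, χ j ω = 0 ∨ χ j ω = 1) {q : ℝ}
    (hcond : ∀ (j : ℕ) (c : ℕ), ∫ ω, (if ∑ i ∈ Finset.range j, χ i ω = (c : ℝ) then (1 : ℝ) else 0)
        * χ j ω ∂μ ≤ q * μ.real {ω | ∑ i ∈ Finset.range j, χ i ω = (c : ℝ)})
    (R : ℕ) {k : ℕ} (hk : 1 ≤ k) :
    μ.real {ω | (k : ℝ) ≤ ∑ i ∈ Finset.range (R + 1), χ i ω}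
      ≤ (1 - q) * μ.real {ω | (k : ℝ) ≤ ∑ i ∈ Finset.range R, χ i ω}
        + q * μ.real {ω | ((k - 1 : ℕ) : ℝ) ≤ ∑ i ∈ Finset.range R, χ i ω} := by
  have hSm := measurable_count hχm R
  have hχb : ∀ j ω, |χ j ω| ≤ 1 := fun j ω => by rcases hχ j ω with h | h <;> simp [h]
  have hind : ∀ (p : α → Prop) [DecidablePred p], MeasurableSet {ω | p ω} →
      Integrable (fun ω => if p ω then (1 : ℝ) else 0) μ := by
    intro p _ hp
    have : (fun ω => if p ω then (1 : ℝ) else 0) = {ω | p ω}.indicator 1 := by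
      funext ω; simp only [Set.indicator_apply, Set.mem_setOf_eq, Pi.one_apply]
    rw [this]
    exact (integrable_const (1 : ℝ)).indicator hp
  have hA : MeasurableSet {ω | (k : ℝ) ≤ ∑ i ∈ Finset.range R, χ i ω} :=
    measurableSet_le measurable_const hSm
  have hE : MeasurableSet {ω | ∑ i ∈ Finset.range R, χ i ω = ((k - 1 : ℕ) : ℝ)} :=
    hSm (measurableSet_singleton _)
  have hiA := hind (fun ω => (k : ℝ) ≤ ∑ i ∈ Finset.range R, χ i ω) hA
  have hiE := hind (fun ω => ∑ i ∈ Finset.range R, χ i ω = ((k - 1 : ℕ) : ℝ)) hE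
  have hiχ : Integrable (χ R) μ := (integrable_const (1 : ℝ)).mono' (hχm R).aestronglyMeasurable
    (ae_of_all _ fun ω => by rw [Real.norm_eq_abs]; exact hχb R ω)
  have hiEχ : Integrable (fun ω => (if ∑ i ∈ Finset.range R, χ i ω = ((k - 1 : ℕ) : ℝ)
      then (1 : ℝ) else 0) * χ R ω) μ :=
    hiχ.bdd_mul (c := 1) hiE.aestronglyMeasurable (ae_of_all _ fun ω => by
      rw [Real.norm_eq_abs]; split_ifs <;> simp)
  -- step 1: the pointwise recursion, integrated
  have h1 : μ.real {ω | (k : ℝ) ≤ ∑ i ∈ Finset.range (R + 1), χ i ω}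
      ≤ μ.real {ω | (k : ℝ) ≤ ∑ i ∈ Finset.range R, χ i ω}
        + ∫ ω, (if ∑ i ∈ Finset.range R, χ i ω = ((k - 1 : ℕ) : ℝ) then (1 : ℝ) else 0)
          * χ R ω ∂μ := by
    rw [measureReal_countGe_eq_integral μ hχm, measureReal_countGe_eq_integral μ hχm,
      ← integral_add hiA hiEχ]
    refine integral_mono (hind _ (measurableSet_le measurable_const
      (measurable_count hχm (R + 1)))) (hiA.add hiEχ) fun ω => ?_
    obtain ⟨n, hn⟩ := exists_nat_eq_sum_zeroOne hχ ω R
    simp only [Finset.sum_range_succ]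
    exact indicator_count_succ_le hn (hχ R ω) hk
  -- step 2: the conditional bound and integrality
  have h2 : μ.real {ω | ((k - 1 : ℕ) : ℝ) ≤ ∑ i ∈ Finset.range R, χ i ω}
      = μ.real {ω | ∑ i ∈ Finset.range R, χ i ω = ((k - 1 : ℕ) : ℝ)}
        + μ.real {ω | (k : ℝ) ≤ ∑ i ∈ Finset.range R, χ i ω} := by
    rw [measureReal_countGe_eq_integral μ hχm, measureReal_countGe_eq_integral μ hχm,
      measureReal_countEq_eq_integral μ hχm, ← integral_add hiE hiA]
    refine integral_congr_ae (ae_of_all _ fun ω => ?_)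
    obtain ⟨n, hn⟩ := exists_nat_eq_sum_zeroOne hχ ω R
    exact indicator_count_pred_eq hn hk
  have h3 := hcond R (k - 1)
  calc μ.real {ω | (k : ℝ) ≤ ∑ i ∈ Finset.range (R + 1), χ i ω}
      ≤ μ.real {ω | (k : ℝ) ≤ ∑ i ∈ Finset.range R, χ i ω}
        + q * μ.real {ω | ∑ i ∈ Finset.range R, χ i ω = ((k - 1 : ℕ) : ℝ)} := by linarith
    _ = (1 - q) * μ.real {ω | (k : ℝ) ≤ ∑ i ∈ Finset.range R, χ i ω}
        + q * μ.real {ω | ((k - 1 : ℕ) : ℝ) ≤ ∑ i ∈ Finset.range R, χ i ω} := by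
      rw [h2]; ring

/-- **THE CHERNOFF-TYPE COUNT BOUND.**  Under `hcond` with `0 ≤ q ≤ 1`, for every `a ≥ 1`, `R`, `k`:
`μ{S_R ≥ k} ≤ (1 − q + q a)^R / a^k` — the Binomial(`R`, `q`) generating-function bound. -/
theorem measureReal_countGe_le (hχm : ∀ j, Measurable (χ j))
    (hχ : ∀ j ω, χ j ω = 0 ∨ χ j ω = 1) {q : ℝ} (hq0 : 0 ≤ q) (hq1 : q ≤ 1)
    (hcond : ∀ (j : ℕ) (c : ℕ), ∫ ω, (if ∑ i ∈ Finset.range j, χ i ω = (c : ℝ) then (1 : ℝ) else 0)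
        * χ j ω ∂μ ≤ q * μ.real {ω | ∑ i ∈ Finset.range j, χ i ω = (c : ℝ)})
    {a : ℝ} (ha : 1 ≤ a) :
    ∀ R k : ℕ, μ.real {ω | (k : ℝ) ≤ ∑ i ∈ Finset.range R, χ i ω} ≤ (1 - q + q * a) ^ R / a ^ k := by
  have ha0 : 0 < a := one_pos.trans_le ha
  have hM1 : 1 ≤ 1 - q + q * a := by nlinarith
  have hM0 : 0 ≤ 1 - q + q * a := zero_le_one.trans hM1
  -- `k = 0`: a probability is at most `1 ≤ M^R`
  have hk0 : ∀ R : ℕ, μ.real {ω | ((0 : ℕ) : ℝ) ≤ ∑ i ∈ Finset.range R, χ i ω}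
      ≤ (1 - q + q * a) ^ R / a ^ 0 := fun R => by
    rw [pow_zero, div_one]
    exact measureReal_le_one.trans (one_le_pow₀ hM1)
  intro R
  induction R with
  | zero =>
    intro k
    rcases Nat.eq_zero_or_pos k with rfl | hk
    · exact hk0 0
    · have hempty : {ω : α | (k : ℝ) ≤ ∑ i ∈ Finset.range 0, χ i ω} = ∅ := by
        ext ω
        simp only [Finset.range_zero, Finset.sum_empty, Set.mem_setOf_eq, Set.mem_empty_iff_false,
          iff_false, not_le]
        exact_mod_cast hk
      rw [hempty, measureReal_empty]
      positivity
  | succ R ih =>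
    intro k
    rcases Nat.eq_zero_or_pos k with rfl | hk
    · exact hk0 (R + 1)
    · have hrec := measureReal_countGe_succ_le μ hχm hχ hcond R hk
      have ih1 := ih k
      have ih2 := ih (k - 1)
      have hak : a ^ k = a ^ (k - 1) * a := by
        rw [← pow_succ, Nat.sub_add_cancel hk]
      calc μ.real {ω | (k : ℝ) ≤ ∑ i ∈ Finset.range (R + 1), χ i ω}
          ≤ (1 - q) * ((1 - q + q * a) ^ R / a ^ k) + q * ((1 - q + q * a) ^ R / a ^ (k - 1)) := by
            refine hrec.trans (add_le_add ?_ ?_)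
            · exact mul_le_mul_of_nonneg_left ih1 (by linarith)
            · exact mul_le_mul_of_nonneg_left ih2 hq0
        _ = (1 - q + q * a) ^ (R + 1) / a ^ k := by
            rw [hak, pow_succ]
            field_simp

/-! ### Numerics: `q ≤ 1/4`, threshold `R/2` -/

omit [MeasurableSpace α] in
/-- `R ≤ 2k ⇒ (3/2)^R / 3^k ≤ e^{−R/8}`. -/
theorem three_halves_pow_div_le_exp {R k : ℕ} (hRk : R ≤ 2 * k) :
    (3 / 2 : ℝ) ^ R / 3 ^ k ≤ Real.exp (-((R : ℝ) / 8)) := by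
  -- compare squares: ((3/2)^R e^{R/8})^2 = ((9/4) e^{1/4})^R ≤ 3^R ≤ 9^k = (3^k)^2
  have h3k : (0 : ℝ) < 3 ^ k := by positivity
  rw [div_le_iff₀ h3k]
  have hsq : ((3 / 2 : ℝ) ^ R) ^ 2 ≤ (Real.exp (-((R : ℝ) / 8)) * 3 ^ k) ^ 2 := by
    have hL : ((3 / 2 : ℝ) ^ R) ^ 2 = (9 / 4 : ℝ) ^ R := by
      rw [← pow_mul, mul_comm, pow_mul]; norm_num
    have hE : (Real.exp (-((R : ℝ) / 8))) ^ 2 = (Real.exp (-(1 / 4 : ℝ))) ^ R := by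
      rw [← Real.exp_nat_mul, ← Real.exp_nat_mul]
      congr 1
      push_cast
      ring
    have h9 : ((3 : ℝ) ^ k) ^ 2 = 9 ^ k := by
      rw [← pow_mul, mul_comm, pow_mul]; norm_num
    rw [hL, mul_pow, hE, h9]
    -- (9/4)^R ≤ (e^{-1/4})^R · 9^k  ⇐  (9/4)^R e^{R/4} ≤ 3^R ≤ 9^k
    have hstep : (9 / 4 : ℝ) ^ R ≤ (Real.exp (-(1 / 4 : ℝ))) ^ R * 3 ^ R := by
      rw [← mul_pow]
      refine pow_le_pow_left₀ (by norm_num) ?_ R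
      rw [Real.exp_neg]
      -- `e^{1/4} ≤ 4/3` since `e ≤ 2.72 ≤ 256/81 = (4/3)^4`
      have hq : Real.exp (1 / 4) ≤ 4 / 3 := by
        have h4 : Real.exp (1 / 4) ^ 4 = Real.exp 1 := by
          rw [← Real.exp_nat_mul]; norm_num
        have he : Real.exp 1 ≤ (4 / 3 : ℝ) ^ 4 := by
          have := Real.exp_one_lt_d9
          norm_num at this ⊢
          linarith
        refine le_of_pow_le_pow_left₀ (by norm_num : (4 : ℕ) ≠ 0) (by norm_num) ?_
        rw [h4]
        exact he
      have hpos : 0 < Real.exp (1 / 4) := Real.exp_pos _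
      rw [le_inv_mul_iff₀ hpos]
      nlinarith
    have h39 : (3 : ℝ) ^ R ≤ 9 ^ k := by
      calc (3 : ℝ) ^ R ≤ 3 ^ (2 * k) := pow_le_pow_right₀ (by norm_num) hRk
        _ = 9 ^ k := by rw [pow_mul]; norm_num
    calc (9 / 4 : ℝ) ^ R ≤ (Real.exp (-(1 / 4 : ℝ))) ^ R * 3 ^ R := hstep
      _ ≤ (Real.exp (-(1 / 4 : ℝ))) ^ R * 9 ^ k :=
          mul_le_mul_of_nonneg_left h39 (pow_nonneg (Real.exp_pos _).le R)
  have hpos1 : (0 : ℝ) ≤ (3 / 2 : ℝ) ^ R := by positivity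
  have hpos2 : (0 : ℝ) ≤ Real.exp (-((R : ℝ) / 8)) * 3 ^ k := by positivity
  exact (pow_le_pow_iff_left₀ hpos1 hpos2 two_ne_zero).1 hsq

/-- **EXPONENTIAL COUNT BOUND AT THRESHOLD `R/2`.**  Under `hcond` with `0 ≤ q ≤ 1/4`:
`μ{S_R ≥ R/2} ≤ e^{−R/8}`. -/
theorem measureReal_countGe_half_le_exp (hχm : ∀ j, Measurable (χ j))
    (hχ : ∀ j ω, χ j ω = 0 ∨ χ j ω = 1) {q : ℝ} (hq0 : 0 ≤ q) (hq4 : q ≤ 1 / 4)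
    (hcond : ∀ (j : ℕ) (c : ℕ), ∫ ω, (if ∑ i ∈ Finset.range j, χ i ω = (c : ℝ) then (1 : ℝ) else 0)
        * χ j ω ∂μ ≤ q * μ.real {ω | ∑ i ∈ Finset.range j, χ i ω = (c : ℝ)})
    (R : ℕ) :
    μ.real {ω | (R : ℝ) / 2 ≤ ∑ i ∈ Finset.range R, χ i ω} ≤ Real.exp (-((R : ℝ) / 8)) := by
  -- the event `{R/2 ≤ S_R}` is `{⌈R/2⌉ ≤ S_R}` by integrality
  set k : ℕ := (R + 1) / 2 with hk
  have hRk : R ≤ 2 * k := by omega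
  have hsub : {ω | (R : ℝ) / 2 ≤ ∑ i ∈ Finset.range R, χ i ω}
      ⊆ {ω | (k : ℝ) ≤ ∑ i ∈ Finset.range R, χ i ω} := by
    intro ω hω
    obtain ⟨n, hn⟩ := exists_nat_eq_sum_zeroOne hχ ω R
    simp only [Set.mem_setOf_eq, hn] at hω ⊢
    have h2 : (R : ℝ) ≤ 2 * n := by linarith
    have h3 : R ≤ 2 * n := by exact_mod_cast h2
    have h4 : k ≤ n := by omega
    exact_mod_cast h4
  have hb := measureReal_countGe_le μ hχm hχ hq0 (by linarith) hcond (a := 3) (by norm_num) R k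
  refine (measureReal_mono hsub).trans (hb.trans ?_)
  have hM : (1 - q + q * 3) ^ R ≤ (3 / 2 : ℝ) ^ R :=
    pow_le_pow_left₀ (by linarith) (by linarith) R
  calc (1 - q + q * 3) ^ R / 3 ^ k ≤ (3 / 2 : ℝ) ^ R / 3 ^ k :=
        div_le_div_of_nonneg_right hM (by positivity)
    _ ≤ Real.exp (-((R : ℝ) / 8)) := three_halves_pow_div_le_exp hRk

end Count

end Summit.Ventures.LatticeQCDFlow.Scoring

end
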